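import Mathlib
import Summits.Ventures.PercRepro.TriangleCapThreeBelowOneTriangleA
import Summits.Ventures.PercRepro.TriangleCapEightThirteenE

/-!
# PercRepro — FOUR BELOW THE DIAGONAL, THE ONE-TRIANGLE RESIDUE, PART A: THE BOOKKEEPING OF THE PRIVATE SET
(p3, gen 39; part 129)

`S = {u, v, w}` the only triangle, `P` the private set of `u`, `R = Sᶜ ∖ P`, `Q ⊆ R` the outer vertices,
`Y = R ∖ Q` the private vertices of `v` and `w`, `a_y = degIn P y`, `t₀ = |P|`, `p = Σ_S degIn Sᶜ`:
* `sigma_le_of_split` — `σ ≤ t₀² + (p − t₀)²` (the other two private sets have `t_v² + t_w² ≤ (t_v + t_w)²`);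
* `density_private` — `2m = 6 + 2p + 2 Σ_R a_y + Σ_R degIn R` (the private-set split of `Q′`);
* `sum_a_le` — `Σ_{Y} a_y ≤ |Y| t₀`;
* `outer_deg_split` — `Σ_Q degIn Sᶜ = Σ_Q a_z + Σ_Q degIn R`;
* `two_mul_sum_outer_degIn_R` — `2 Σ_Q degIn R z + |Y| (|Y| − 1) ≥ Σ_R degIn R` (the edges inside `R` not at an
  outer vertex lie inside `Y`);
* `edge_count_private` — `Σ_R a_y + e(R) = m − 3 − p`, hence `m − 3 − p ≤ |R| t₀ + e(R)` (the sparse lopsided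
  configurations are not dense).
Axioms: standard.
-/

namespace PercRepro

namespace TriangleCap

namespace C047

open Finset

variable {V : Type*} [Fintype V] [DecidableEq V]

/-- `σ ≤ t_u² + (t_v + t_w)²`. -/
theorem sigma_le_of_split (D : SimpleGraph V) [DecidableRel D.Adj] {u v w : V} (huv : D.Adj u v)
    (huw : D.Adj u w) (hvw : D.Adj v w) :
    ∑ x ∈ ({u, v, w} : Finset V), degIn D ({u, v, w} : Finset V)ᶜ x * degIn D ({u, v, w} : Finset V)ᶜ x ≤
      degIn D ({u, v, w} : Finset V)ᶜ u * degIn D ({u, v, w} : Finset V)ᶜ u +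
        (degIn D ({u, v, w} : Finset V)ᶜ v + degIn D ({u, v, w} : Finset V)ᶜ w) *
          (degIn D ({u, v, w} : Finset V)ᶜ v + degIn D ({u, v, w} : Finset V)ᶜ w) := by
  have huvw : u ∉ ({v, w} : Finset V) := by
    rw [mem_insert, mem_singleton, not_or]; exact ⟨huv.ne, huw.ne⟩
  have hvw' : v ∉ ({w} : Finset V) := by rw [mem_singleton]; exact hvw.ne
  rw [sum_insert huvw, sum_insert hvw', sum_singleton]
  nlinarith

/-- `σ = t_u² + t_v² + t_w²`. -/
theorem sigma_eq_split (D : SimpleGraph V) [DecidableRel D.Adj] {u v w : V} (huv : D.Adj u v)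
    (huw : D.Adj u w) (hvw : D.Adj v w) :
    ∑ x ∈ ({u, v, w} : Finset V), degIn D ({u, v, w} : Finset V)ᶜ x * degIn D ({u, v, w} : Finset V)ᶜ x =
      degIn D ({u, v, w} : Finset V)ᶜ u * degIn D ({u, v, w} : Finset V)ᶜ u +
        degIn D ({u, v, w} : Finset V)ᶜ v * degIn D ({u, v, w} : Finset V)ᶜ v +
        degIn D ({u, v, w} : Finset V)ᶜ w * degIn D ({u, v, w} : Finset V)ᶜ w := by
  have huvw : u ∉ ({v, w} : Finset V) := by
    rw [mem_insert, mem_singleton, not_or]; exact ⟨huv.ne, huw.ne⟩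
  have hvw' : v ∉ ({w} : Finset V) := by rw [mem_singleton]; exact hvw.ne
  rw [sum_insert huvw, sum_insert hvw', sum_singleton]
  ring

/-- `Σ_S degIn Sᶜ = t_u + t_v + t_w`. -/
theorem sum_private_eq (D : SimpleGraph V) [DecidableRel D.Adj] {u v w : V} (huv : D.Adj u v)
    (huw : D.Adj u w) (hvw : D.Adj v w) :
    ∑ x ∈ ({u, v, w} : Finset V), degIn D ({u, v, w} : Finset V)ᶜ x =
      degIn D ({u, v, w} : Finset V)ᶜ u + degIn D ({u, v, w} : Finset V)ᶜ v +
        degIn D ({u, v, w} : Finset V)ᶜ w := by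
  have huvw : u ∉ ({v, w} : Finset V) := by
    rw [mem_insert, mem_singleton, not_or]; exact ⟨huv.ne, huw.ne⟩
  have hvw' : v ∉ ({w} : Finset V) := by rw [mem_singleton]; exact hvw.ne
  rw [sum_insert huvw, sum_insert hvw', sum_singleton]
  ring

/-- The private set of `u` is `Sᶜ.filter (Adj u)` and its cardinality is `degIn Sᶜ u`. -/
theorem card_priv_eq (D : SimpleGraph V) [DecidableRel D.Adj] (S : Finset V) (u : V) :
    (Sᶜ.filter (fun x => D.Adj u x)).card = degIn D Sᶜ u := rfl

/-- **THE DENSITY THROUGH THE PRIVATE SET:** with `P ⊆ Sᶜ` independent and `R = Sᶜ ∖ P`,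
`Σ_{Sᶜ} degIn Sᶜ = 2 Σ_R degIn P + Σ_R degIn R`. -/
theorem sum_degIn_compl_split (D : SimpleGraph V) [DecidableRel D.Adj] (S P : Finset V) (hPS : P ⊆ Sᶜ)
    (hPind : ∀ x ∈ P, ∀ x' ∈ P, ¬ D.Adj x x') :
    ∑ x ∈ Sᶜ, degIn D Sᶜ x = 2 * ∑ y ∈ Sᶜ \ P, degIn D P y + ∑ y ∈ Sᶜ \ P, degIn D (Sᶜ \ P) y := by
  have hAR : Sᶜ = P ∪ (Sᶜ \ P) := (union_sdiff_of_subset hPS).symm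
  have hd : Disjoint P (Sᶜ \ P) := disjoint_sdiff
  have h1 : ∀ x ∈ P, degIn D Sᶜ x = degIn D (Sᶜ \ P) x := by
    intro x hx
    unfold degIn
    congr 1
    ext t
    rw [mem_filter, mem_filter, mem_sdiff]
    constructor
    · rintro ⟨ht, hxt⟩
      exact ⟨⟨ht, fun htP => hPind x hx t htP hxt⟩, hxt⟩
    · rintro ⟨⟨ht, -⟩, hxt⟩
      exact ⟨ht, hxt⟩
  have h2 : ∀ y ∈ Sᶜ \ P, degIn D Sᶜ y = degIn D P y + degIn D (Sᶜ \ P) y := by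
    intro y _
    have := degIn_union_of_disjoint D hd y
    rw [← hAR] at this
    exact this
  rw [← sum_sdiff hPS, sum_congr rfl h1, sum_congr rfl h2, sum_add_distrib, sum_degIn_comm D P (Sᶜ \ P)]
  ring

omit [Fintype V] [DecidableEq V] in
/-- `Σ_{y ∈ Y} degIn P y ≤ |Y| · |P|`. -/
theorem sum_degIn_le_card_mul (D : SimpleGraph V) [DecidableRel D.Adj] (P Y : Finset V) :
    ∑ y ∈ Y, degIn D P y ≤ Y.card * P.card := by
  calc ∑ y ∈ Y, degIn D P y ≤ ∑ _y ∈ Y, P.card := sum_le_sum (fun y _ => degIn_le_card D P y)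
    _ = Y.card * P.card := by rw [sum_const, smul_eq_mul]

/-- `Σ_Q degIn Sᶜ = Σ_Q degIn P + Σ_Q degIn R` (`R = Sᶜ ∖ P`). -/
theorem sum_outer_degIn_split (D : SimpleGraph V) [DecidableRel D.Adj] (S P Q : Finset V) (hPS : P ⊆ Sᶜ) :
    ∑ z ∈ Q, degIn D Sᶜ z = ∑ z ∈ Q, degIn D P z + ∑ z ∈ Q, degIn D (Sᶜ \ P) z := by
  have hAR : Sᶜ = P ∪ (Sᶜ \ P) := (union_sdiff_of_subset hPS).symm
  have hd : Disjoint P (Sᶜ \ P) := disjoint_sdiff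
  rw [← sum_add_distrib]
  apply sum_congr rfl
  intro z _
  have := degIn_union_of_disjoint D hd z
  rw [← hAR] at this
  exact this

omit [Fintype V] in
/-- **THE EDGES INSIDE `R` NOT AT AN OUTER VERTEX LIE INSIDE `Y = R ∖ Q`:**
`Σ_R degIn R ≤ 2 Σ_Q degIn R + |Y| (|Y| − 1)`. -/
theorem sum_degIn_R_le (D : SimpleGraph V) [DecidableRel D.Adj] (R Q : Finset V) (hQ : Q ⊆ R) :
    ∑ y ∈ R, degIn D R y ≤ 2 * ∑ z ∈ Q, degIn D R z + (R \ Q).card * ((R \ Q).card - 1) := by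
  have hRQ : R = Q ∪ (R \ Q) := (union_sdiff_of_subset hQ).symm
  have hd : Disjoint Q (R \ Q) := disjoint_sdiff
  have hsplit : ∑ y ∈ R, degIn D R y = ∑ z ∈ Q, degIn D R z + ∑ y ∈ R \ Q, degIn D R y := by
    rw [← sum_sdiff hQ]; ring
  have hY : ∀ y ∈ R \ Q, degIn D R y = degIn D Q y + degIn D (R \ Q) y := by
    intro y _
    have := degIn_union_of_disjoint D hd y
    rw [← hRQ] at this
    exact this
  have hY' : ∑ y ∈ R \ Q, degIn D R y = ∑ y ∈ R \ Q, degIn D Q y + ∑ y ∈ R \ Q, degIn D (R \ Q) y := by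
    rw [← sum_add_distrib]; exact sum_congr rfl hY
  have hcomm : ∑ y ∈ R \ Q, degIn D Q y = ∑ z ∈ Q, degIn D (R \ Q) z := sum_degIn_comm D (R \ Q) Q
  have hQle : ∑ z ∈ Q, degIn D (R \ Q) z ≤ ∑ z ∈ Q, degIn D R z := by
    apply sum_le_sum
    intro z _
    unfold degIn
    apply card_le_card
    intro t ht
    rw [mem_filter] at ht ⊢
    exact ⟨sdiff_subset ht.1, ht.2⟩
  have hYY : ∑ y ∈ R \ Q, degIn D (R \ Q) y ≤ (R \ Q).card * ((R \ Q).card - 1) := by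
    calc ∑ y ∈ R \ Q, degIn D (R \ Q) y ≤ ∑ _y ∈ R \ Q, ((R \ Q).card - 1) :=
          sum_le_sum (fun y hy => degIn_le_card_sub_one D hy)
      _ = (R \ Q).card * ((R \ Q).card - 1) := by rw [sum_const, smul_eq_mul]
  omega

/-- A vertex of `R` adjacent to `y ∈ R` shares no neighbour in `P` with it (`Sᶜ` is triangle-free). -/
theorem degIn_add_degIn_le_of_adj (D : SimpleGraph V) [DecidableRel D.Adj] (S P : Finset V) (hPS : P ⊆ Sᶜ)
    (hnotri : ∀ y ∈ Sᶜ, ∀ y' ∈ Sᶜ, ∀ t ∈ Sᶜ, D.Adj y y' → D.Adj y t → D.Adj y' t → False)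
    {y y' : V} (hy : y ∈ Sᶜ) (hy' : y' ∈ Sᶜ) (hyy' : D.Adj y y') :
    degIn D P y + degIn D P y' ≤ P.card := by
  have hd : Disjoint (P.filter (fun t => D.Adj y t)) (P.filter (fun t => D.Adj y' t)) := by
    rw [disjoint_left]
    intro t h1 h2
    rw [mem_filter] at h1 h2
    exact hnotri y hy y' hy' t (hPS h1.1) hyy' h1.2 h2.2
  have := card_le_card (union_subset (filter_subset _ _) (filter_subset _ _) :
    P.filter (fun t => D.Adj y t) ∪ P.filter (fun t => D.Adj y' t) ⊆ P)
  rw [card_union_of_disjoint hd] at this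
  exact this

/-- A term `a (t − a)` with `0 < a < t` is at least `t − 1`. -/
theorem mul_sub_ge_of_strict (a t : ℕ) (ha : 1 ≤ a) (hat : a + 1 ≤ t) : t - 1 ≤ a * (t - a) := by
  obtain ⟨b, rfl⟩ : ∃ b, t = a + 1 + b := ⟨t - a - 1, by omega⟩
  have e1 : a + 1 + b - 1 = a + b := by omega
  have e2 : a + 1 + b - a = 1 + b := by omega
  rw [e1, e2]
  nlinarith

end C047

end TriangleCap

end PercRepro
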